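import Literature.RingTheory.FittingIdeal.LocalRing
import Literature.RingTheory.FittingIdeal.FreeModule
import HarnessLib

/-!
# Free of rank `r` over a local ring iff `Fit_{r-1} = 0` and `Fit_r = R` (Stacks 07ZD)

Topic: `Literature/RingTheory/FittingIdeal`. The Stacks Project, Tag 07ZD (More on Algebra,
Lemma 15.8.8): "Let `R` be a ring. Let `M` be a finite `R`-module. Let `r ≥ 0`. The following
are equivalent (1) `M` is finite locally free of rank `r`, (2) `Fit_{r-1}(M) = 0` and
`Fit_r(M) = R`, and (3) `Fit_k(M) = 0` for `k < r` and `Fit_k(M) = R` for `k ≥ r`." Over a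
LOCAL ring (where finite locally free of rank `r` means free of rank `r`) this file proves the
equivalence of (1) and (3) (and (2) ⇔ (3) is monotonicity of the Fitting ideals,
`Module.fittingIdeal_mono`), following the printed proof: "By Lemma 15.8.7 (Tag 07ZC) we may
assume that `M` is generated by `r` elements […] the assumption that `Fit_{r-1}(M) = 0`
implies that all entries of the matrix of the map `⊕ R → R^{⊕ r}` are zero. Thus `M` is free."
This is the criterion by which flattening by blowing up Fitting ideals (Stacks 0810, Step 9)
recognises local freeness of the strict transform.

* `Module.linearIndependent_of_fittingIdeal_eq_bot` — generators `x₁, …, x_r` with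
  `Fit_{r-1}(M) = 0` are linearly independent (the `1 × 1` relation minors vanish);
* `Module.nonempty_basis_of_fittingIdeal` — (3) ⇒ (1) over a local ring;
* `Module.nonempty_basis_iff_fittingIdeal` — **Stacks 07ZD over a local ring.**

## References

* The Stacks Project, Tag 07ZD (More on Algebra, Lemma 15.8.8); Tags 07ZC, 07Z7.
  [StacksProject]
-/

namespace Literature.RingTheory.FittingIdeal

universe u v

variable {R : Type u} [CommRing R] {M : Type v} [AddCommGroup M] [Module R M]

/-- **Generators with vanishing `Fit_{r-1}` are free**: if `x₁, …, x_r` generate `M` and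
`Fit_{r-1}(M) = 0`, then the `xᵢ` are linearly independent — every coefficient of a relation
is a `1 × 1` relation minor, hence lies in `Fit_{r-1}(M) = 0`. [cite: StacksProject, Tag 07ZD (proof)] -/
theorem Module.linearIndependent_of_fittingIdeal_eq_bot {r : ℕ} (x : Fin r → M)
    (hx : Submodule.span R (Set.range x) = ⊤)
    (hbot : ∀ k < r, Module.fittingIdeal R M k = ⊥) : LinearIndependent R x := by
  refine Fintype.linearIndependent_iff.mpr fun g hg i => ?_
  have hr : r - 1 < r := by
    have := i.pos
    omega
  have hfit : Module.fittingIdeal R M (r - 1) = Module.relMinorIdeal R x 1 := by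
    rw [Module.fittingIdeal_eq_relMinorIdeal x hx (r - 1)]
    congr 1
    have := i.pos
    omega
  have hmem : Matrix.det (Matrix.of fun (_ : Fin 1) (_ : Fin 1) => g i) ∈
      Module.relMinorIdeal R x 1 :=
    Module.det_mem_relMinorIdeal x (fun _ => g) (fun _ => hg) (fun _ => i)
  rw [Matrix.det_unique, Matrix.of_apply, ← hfit, hbot _ hr] at hmem
  exact (Submodule.mem_bot R).mp hmem

/-- **Stacks 07ZD, (3) ⇒ (1), over a local ring**: a finite module over a local ring with
`Fit_k(M) = 0` for `k < r` and `Fit_r(M) = R` is free of rank `r`.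
[cite: StacksProject, Tag 07ZD] -/
theorem Module.nonempty_basis_of_fittingIdeal [IsLocalRing R] [Module.Finite R M] {r : ℕ}
    (htop : Module.fittingIdeal R M r = ⊤) (hbot : ∀ k < r, Module.fittingIdeal R M k = ⊥) :
    Nonempty (Module.Basis (Fin r) R M) := by
  obtain ⟨x, hx⟩ := Module.exists_span_eq_top_of_fittingIdeal_eq_top htop
  exact ⟨Module.Basis.mk (Module.linearIndependent_of_fittingIdeal_eq_bot x hx hbot) (le_of_eq hx.symm)⟩

/-- **Stacks, Tag 07ZD (More on Algebra, Lemma 15.8.8) over a local ring**: a finite module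
`M` over a local ring `R` is free of rank `r` iff `Fit_k(M) = 0` for `k < r` and
`Fit_r(M) = R` (equivalently, by monotonicity, `Fit_{r-1}(M) = 0` and `Fit_r(M) = R`).
[cite: StacksProject, Tag 07ZD] -/
theorem Module.nonempty_basis_iff_fittingIdeal [IsLocalRing R] [Module.Finite R M] {r : ℕ} :
    Nonempty (Module.Basis (Fin r) R M) ↔
      Module.fittingIdeal R M r = ⊤ ∧ ∀ k < r, Module.fittingIdeal R M k = ⊥ := by
  constructor
  · rintro ⟨b⟩
    refine ⟨?_, fun k hk => ?_⟩
    · rw [Module.fittingIdeal_of_basis b, if_pos le_rfl]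
    · rw [Module.fittingIdeal_of_basis b, if_neg (not_le.mpr hk)]
  · rintro ⟨htop, hbot⟩
    exact Module.nonempty_basis_of_fittingIdeal htop hbot

end Literature.RingTheory.FittingIdeal
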